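import Summits.AtomisticToContinuum.BoseEinsteinCondensation.Theses.BECRewardDescent
import Summits.AtomisticToContinuum.BoseEinsteinCondensation.Theorems.BECRewardDescentWalkGlueCurve
import Summits.AtomisticToContinuum.BoseEinsteinCondensation.Theorems.BECRewardDescentRewardChordBoundNoKinkOfSimple
import Summits.AtomisticToContinuum.BoseEinsteinCondensation.Theorems.BECRewardDescentRewardChordBoundModulusOfSimple
import Summits.AtomisticToContinuum.BoseEinsteinCondensation.Theorems.BECRewardDescentRewardChordBoundChordFromModulus
import Summits.AtomisticToContinuum.BoseEinsteinCondensation.Theorems.BECRewardDescentRewardScaleChord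
import Summits.AtomisticToContinuum.BoseEinsteinCondensation.Theorems.BECRewardDescentRewardChordBoundKyFanGapIntegrable
import Summits.AtomisticToContinuum.BoseEinsteinCondensation.Theorems.BECRewardDescentRewardChordBoundZeroMomentumIntegrable

/-!
# Crux `RewardChordBound` (stmt-AtomisticToContinuum-12876), line `registered`/birth — the sorry-free REDUCTION
# of the crux to its three named open inputs

Route `route-AtomisticToContinuum-BECRewardDescent`, sub-problem `BoseEinsteinCondensation`. This helper file (it does
not close the item) records in the tree, kernel-checked, what the lead's skeleton `Cruxes/RewardChordBound/Lines/birth.lean`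
proves once its `sorry`s are read as hypotheses. With the landed stubs of the line —
`stub_noKinkOfSimple` (no kink of the reward curve from a strict Ky-Fan gap), `stub_modulusOfSimple` (the
derivative-free `χ ≤ 2Var/Δ` Temple bound), `stub_chordFromModulus` (the real-analysis walk), `stub_rewardedKyFanGapIntegrable`
and `stub_rewardedZeroMomentumIntegrable` (Perron–Frobenius for the REWARDED form `⟨·,H·⟩ + s(N − n̂₀)`, integrable pair
potentials) — and the proved route items `RewardScaleChord` (`Theorems.rewardScaleChord_proof`) and `PeriodicEnergyFinite`:

* `rewardChordBound_at` — the walk at a FIXED potential `v`: the bodies of `SectorGap` and `CondensateVariance` at `v` and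
  the Perron–Frobenius input at `v` (strict all-pairs Ky-Fan gap of `F_s` + translation-invariant near-minimisers, low density,
  eventually in `N`, every `s > 0`) imply the body of `RewardChordBound` at `v`;
* `rewardChordBound_integrable_of_sectorGap_of_condensateVariance` — for INTEGRABLE `v` (`∫ v(|x|)dx < ∞`: soft cores,
  no hard core) the Perron–Frobenius input is a theorem, so `SectorGap ∧ CondensateVariance` alone give the chord bound: the
  crux holds for every integrable repulsive finite-range potential modulo the route's two Bogoliubov cruxes ONLY;
* `rewardChordBound_of_sectorGap_of_condensateVariance_of_nonintegrableSimple` (= registered anchor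
  `stub_rewardChordBoundReduction`) — for ALL admissible `v`: `SectorGap → CondensateVariance → NonintegrableSimple → RewardChordBound`,
  where `NonintegrableSimple` is verbatim the line's last open stub `stub_rewardedSimpleNonintegrable` (the hard-core kernel:
  simplicity and zero momentum of the rewarded ground state for non-integrable profiles at low density).

So the crux is closed MODULO exactly: `SectorGap` (stmt-12874), `CondensateVariance` (stmt-12875), and the hard-core
Perron–Frobenius kernel; and the glue item `WalkGlue` (stmt-12880) holds for integrable potentials / modulo that kernel.

References: route text of BECRewardDescent; [Kato1966] Ch. VII §3; [Griffiths1966]; [ReedSimonIV1978] §XIII.12.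
-/

namespace Summit.AtomisticToContinuum.BoseEinsteinCondensation.Cruxes.RewardChordBound.Birth

open scoped BigOperators Topology Classical ENNReal
open Filter Set MeasureTheory

/-- **The reward walk at a fixed potential.** For a repulsive finite-range `v` and `τ > 0`: IF (gap) the body of
`SectorGap` holds at `v` (conditional `P = 0` Ky-Fan gap `c√(ρa)√s` for `(1−η)`-condensed near-minimisers), (var) the body
of `CondensateVariance` holds at `v` (`⟨n̂₀²⟩ ≤ ⟨n̂₀⟩² + CN` for condensed near-minimisers), and (pf) at low density, eventually
in `N`, for every reward `s > 0` with `R(s) < ∞` the rewarded functional `F_s` has a strict Ky-Fan gap over all orthogonal pairs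
and translation-invariant near-minimisers at every precision, THEN the body of `RewardChordBound` holds at `v`: there are
`θ, ρ₀ > 0` with `R(s) + (s/s₀)E₀ ≤ E₀ + (s/s₀)R(s₀) + sτN` for `0 < s ≤ s₀ = θρa`, `ρ < ρ₀`, eventually in `N`. Proof: the
skeleton of the line — `η := min η₁ η₂`, `θ` from `stub_chordFromModulus`, `ρ₀ := min` of the five thresholds (gap, var, the
PROVED rung `rewardScaleChord_proof` at `τ := η/4`, `PeriodicEnergyFinite_holds`, pf), finiteness of every `R(t)`
(`WalkGlue.iInf_affine_ne_top`), then `stub_chordFromModulus` fed with the rung at `s₀`, `stub_noKinkOfSimple` ← pf(i), and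
`stub_modulusOfSimple` ← pf(ii) on `[s−h, s+h] ⊂ (0,∞)` + gap + var at `g = c√(ρa)√s`, `V = CN`. [folklore] -/
theorem rewardChordBound_at (v : ℝ → ENNReal) (hv : Literature.MathematicalPhysics.QuantumManyBody.BoseGas.IsRepulsiveFiniteRange v) (τ : ℝ) (hτ : 0 < τ)
    (hGap : (∃ η c ρ₀ : ℝ, 0 < η ∧ 0 < c ∧ 0 < ρ₀ ∧ ∀ ρ : ℝ, 0 < ρ → ρ < ρ₀ → ∀ᶠ N : ℕ in Filter.atTop, ∀ s : ℝ, 0 < s → s ≤ ρ * (Literature.MathematicalPhysics.QuantumManyBody.BoseGas.scatteringLength v).toReal → (∃ δ : ENNReal, 0 < δ ∧ ∀ Ψ : Literature.MathematicalPhysics.QuantumManyBody.BoseGas.PeriodicTrialState N (Literature.MathematicalPhysics.QuantumManyBody.BoseGas.sideLength ρ N), (Literature.MathematicalPhysics.QuantumManyBody.BoseGas.periodicEnergy v Ψ + ENNReal.ofReal s * ((N : ENNReal) - Literature.MathematicalPhysics.QuantumManyBody.BoseGas.condensateOccupation N (Literature.MathematicalPhysics.QuantumManyBody.BoseGas.sideLength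 ρ N) Ψ.ψ)) ≤ (⨅ Ψ : Literature.MathematicalPhysics.QuantumManyBody.BoseGas.PeriodicTrialState N (Literature.MathematicalPhysics.QuantumManyBody.BoseGas.sideLength ρ N), (Literature.MathematicalPhysics.QuantumManyBody.BoseGas.periodicEnergy v Ψ + ENNReal.ofReal s * ((N : ENNReal) - Literature.MathematicalPhysics.QuantumManyBody.BoseGas.condensateOccupation N (Literature.MathematicalPhysics.QuantumManyBody.BoseGas.sideLength ρ N) Ψ.ψ))) + δ → ENNReal.ofReal ((1 - η) * N) ≤ Literature.MathematicalPhysics.QuantumManyBody.BoseGas.condensateOccupation N (Literature.MathematicalPhysics.QuantumManyBody.BoseGas.sideLength ρ N) Ψ.ψ) → (∀ Φ₁ Φ₂ : Literature.MathematicalPhysics.QuantumManyBody.BoseGas.PeriodicTrialState N (Literature.MathematicalPhysics.QuantumManyBody.BoseGas.sideLength ρ N), (∀ (X : Literature.MathematicalPhysics.QuantumManyBody.BoseGas.Config N) (t : EuclideanSpace ℝ (Fin 3)), Φ₁.ψ (fun i => X i + t) = Φ₁.ψ X) → (∀ (X : Literature.MathematicalPhysics.QuantumManyBody.BoseGas.Config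 N) (t : EuclideanSpace ℝ (Fin 3)), Φ₂.ψ (fun i => X i + t) = Φ₂.ψ X) → (∫ X in Literature.MathematicalPhysics.QuantumManyBody.BoseGas.cellN N (Literature.MathematicalPhysics.QuantumManyBody.BoseGas.sideLength ρ N), starRingEnd ℂ (Φ₁.ψ X) * Φ₂.ψ X) = 0 → 2 * (⨅ Ψ : Literature.MathematicalPhysics.QuantumManyBody.BoseGas.PeriodicTrialState N (Literature.MathematicalPhysics.QuantumManyBody.BoseGas.sideLength ρ N), (Literature.MathematicalPhysics.QuantumManyBody.BoseGas.periodicEnergy v Ψ + ENNReal.ofReal s * ((N : ENNReal) - Literature.MathematicalPhysics.QuantumManyBody.BoseGas.condensateOccupation N (Literature.MathematicalPhysics.QuantumManyBody.BoseGas.sideLength ρ N) Ψ.ψ))) + ENNReal.ofReal (c * Real.sqrt (ρ * (Literature.MathematicalPhysics.QuantumManyBody.BoseGas.scatteringLength v).toReal) * Real.sqrt s) ≤ (Literature.MathematicalPhysics.QuantumManyBody.BoseGas.periodicEnergy v Φ₁ + ENNReal.ofReal s * ((N : ENNReal) - Literature.MathematicalPhysics.QuantumManyBody.BoseGas.condensateOccupation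 N (Literature.MathematicalPhysics.QuantumManyBody.BoseGas.sideLength ρ N) Φ₁.ψ)) + (Literature.MathematicalPhysics.QuantumManyBody.BoseGas.periodicEnergy v Φ₂ + ENNReal.ofReal s * ((N : ENNReal) - Literature.MathematicalPhysics.QuantumManyBody.BoseGas.condensateOccupation N (Literature.MathematicalPhysics.QuantumManyBody.BoseGas.sideLength ρ N) Φ₂.ψ)))))
    (hVar : (∃ η C ρ₀ : ℝ, 0 < η ∧ 0 < C ∧ 0 < ρ₀ ∧ ∀ ρ : ℝ, 0 < ρ → ρ < ρ₀ → ∀ᶠ N : ℕ in Filter.atTop, ∀ s : ℝ, 0 < s → s ≤ ρ * (Literature.MathematicalPhysics.QuantumManyBody.BoseGas.scatteringLength v).toReal → (∃ δ : ENNReal, 0 < δ ∧ ∀ Ψ : Literature.MathematicalPhysics.QuantumManyBody.BoseGas.PeriodicTrialState N (Literature.MathematicalPhysics.QuantumManyBody.BoseGas.sideLength ρ N), (Literature.MathematicalPhysics.QuantumManyBody.BoseGas.periodicEnergy v Ψ + ENNReal.ofReal s * ((N : ENNReal) - Literature.MathematicalPhysics.QuantumManyBody.BoseGas.condensateOccupation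 N (Literature.MathematicalPhysics.QuantumManyBody.BoseGas.sideLength ρ N) Ψ.ψ)) ≤ (⨅ Ψ : Literature.MathematicalPhysics.QuantumManyBody.BoseGas.PeriodicTrialState N (Literature.MathematicalPhysics.QuantumManyBody.BoseGas.sideLength ρ N), (Literature.MathematicalPhysics.QuantumManyBody.BoseGas.periodicEnergy v Ψ + ENNReal.ofReal s * ((N : ENNReal) - Literature.MathematicalPhysics.QuantumManyBody.BoseGas.condensateOccupation N (Literature.MathematicalPhysics.QuantumManyBody.BoseGas.sideLength ρ N) Ψ.ψ))) + δ → ENNReal.ofReal ((1 - η) * N) ≤ Literature.MathematicalPhysics.QuantumManyBody.BoseGas.condensateOccupation N (Literature.MathematicalPhysics.QuantumManyBody.BoseGas.sideLength ρ N) Ψ.ψ) → (∃ δ : ENNReal, 0 < δ ∧ ∀ Ψ : Literature.MathematicalPhysics.QuantumManyBody.BoseGas.PeriodicTrialState N (Literature.MathematicalPhysics.QuantumManyBody.BoseGas.sideLength ρ N), (Literature.MathematicalPhysics.QuantumManyBody.BoseGas.periodicEnergy v Ψ + ENNReal.ofReal s * ((N : ENNReal) - Literature.MathematicalPhysics.QuantumManyBody.BoseGas.condensateOccupation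 N (Literature.MathematicalPhysics.QuantumManyBody.BoseGas.sideLength ρ N) Ψ.ψ)) ≤ (⨅ Ψ : Literature.MathematicalPhysics.QuantumManyBody.BoseGas.PeriodicTrialState N (Literature.MathematicalPhysics.QuantumManyBody.BoseGas.sideLength ρ N), (Literature.MathematicalPhysics.QuantumManyBody.BoseGas.periodicEnergy v Ψ + ENNReal.ofReal s * ((N : ENNReal) - Literature.MathematicalPhysics.QuantumManyBody.BoseGas.condensateOccupation N (Literature.MathematicalPhysics.QuantumManyBody.BoseGas.sideLength ρ N) Ψ.ψ))) + δ → ENNReal.ofReal (((Literature.MathematicalPhysics.QuantumManyBody.BoseGas.sideLength ρ N) ^ 3)⁻¹ ^ 2) * (∫⁻ X in Literature.MathematicalPhysics.QuantumManyBody.BoseGas.cellN N (Literature.MathematicalPhysics.QuantumManyBody.BoseGas.sideLength ρ N), (‖∑ i : Fin N, ∫ y in Literature.MathematicalPhysics.QuantumManyBody.BoseGas.cell (Literature.MathematicalPhysics.QuantumManyBody.BoseGas.sideLength ρ N), Ψ.ψ (Function.update X i y)‖₊ : ENNReal) ^ 2) ≤ Literature.MathematicalPhysics.QuantumManyBody.BoseGas.condensateOccupation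 N (Literature.MathematicalPhysics.QuantumManyBody.BoseGas.sideLength ρ N) Ψ.ψ ^ 2 + ENNReal.ofReal (C * N))))
    (hSimple : (∃ ρ₅ : ℝ, 0 < ρ₅ ∧ ∀ ρ : ℝ, 0 < ρ → ρ < ρ₅ → ∀ᶠ N : ℕ in Filter.atTop, ∀ s : ℝ, 0 < s → (⨅ Ψ : Literature.MathematicalPhysics.QuantumManyBody.BoseGas.PeriodicTrialState N (Literature.MathematicalPhysics.QuantumManyBody.BoseGas.sideLength ρ N), (Literature.MathematicalPhysics.QuantumManyBody.BoseGas.periodicEnergy v Ψ + ENNReal.ofReal s * ((N : ENNReal) - Literature.MathematicalPhysics.QuantumManyBody.BoseGas.condensateOccupation N (Literature.MathematicalPhysics.QuantumManyBody.BoseGas.sideLength ρ N) Ψ.ψ))) ≠ ⊤ → (∃ g : ℝ, 0 < g ∧ (∀ Φ₁ Φ₂ : Literature.MathematicalPhysics.QuantumManyBody.BoseGas.PeriodicTrialState N (Literature.MathematicalPhysics.QuantumManyBody.BoseGas.sideLength ρ N), (∫ X in Literature.MathematicalPhysics.QuantumManyBody.BoseGas.cellN N (Literature.MathematicalPhysics.QuantumManyBody.BoseGas.sideLength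 ρ N), starRingEnd ℂ (Φ₁.ψ X) * Φ₂.ψ X) = 0 → 2 * (⨅ Ψ : Literature.MathematicalPhysics.QuantumManyBody.BoseGas.PeriodicTrialState N (Literature.MathematicalPhysics.QuantumManyBody.BoseGas.sideLength ρ N), (Literature.MathematicalPhysics.QuantumManyBody.BoseGas.periodicEnergy v Ψ + ENNReal.ofReal s * ((N : ENNReal) - Literature.MathematicalPhysics.QuantumManyBody.BoseGas.condensateOccupation N (Literature.MathematicalPhysics.QuantumManyBody.BoseGas.sideLength ρ N) Ψ.ψ))) + ENNReal.ofReal g ≤ (Literature.MathematicalPhysics.QuantumManyBody.BoseGas.periodicEnergy v Φ₁ + ENNReal.ofReal s * ((N : ENNReal) - Literature.MathematicalPhysics.QuantumManyBody.BoseGas.condensateOccupation N (Literature.MathematicalPhysics.QuantumManyBody.BoseGas.sideLength ρ N) Φ₁.ψ)) + (Literature.MathematicalPhysics.QuantumManyBody.BoseGas.periodicEnergy v Φ₂ + ENNReal.ofReal s * ((N : ENNReal) - Literature.MathematicalPhysics.QuantumManyBody.BoseGas.condensateOccupation N (Literature.MathematicalPhysics.QuantumManyBody.BoseGas.sideLength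 ρ N) Φ₂.ψ)))) ∧ (∀ δ : ENNReal, 0 < δ → ∃ Ψ : Literature.MathematicalPhysics.QuantumManyBody.BoseGas.PeriodicTrialState N (Literature.MathematicalPhysics.QuantumManyBody.BoseGas.sideLength ρ N), (∀ (X : Literature.MathematicalPhysics.QuantumManyBody.BoseGas.Config N) (t : EuclideanSpace ℝ (Fin 3)), Ψ.ψ (fun i => X i + t) = Ψ.ψ X) ∧ (Literature.MathematicalPhysics.QuantumManyBody.BoseGas.periodicEnergy v Ψ + ENNReal.ofReal s * ((N : ENNReal) - Literature.MathematicalPhysics.QuantumManyBody.BoseGas.condensateOccupation N (Literature.MathematicalPhysics.QuantumManyBody.BoseGas.sideLength ρ N) Ψ.ψ)) ≤ (⨅ Ψ : Literature.MathematicalPhysics.QuantumManyBody.BoseGas.PeriodicTrialState N (Literature.MathematicalPhysics.QuantumManyBody.BoseGas.sideLength ρ N), (Literature.MathematicalPhysics.QuantumManyBody.BoseGas.periodicEnergy v Ψ + ENNReal.ofReal s * ((N : ENNReal) - Literature.MathematicalPhysics.QuantumManyBody.BoseGas.condensateOccupation N (Literature.MathematicalPhysics.QuantumManyBody.BoseGas.sideLength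 ρ N) Ψ.ψ))) + δ))) :
    ∃ θ ρ₀ : ℝ, 0 < θ ∧ 0 < ρ₀ ∧ ∀ ρ : ℝ, 0 < ρ → ρ < ρ₀ → ∀ᶠ N : ℕ in Filter.atTop, ∀ s : ℝ, 0 < s → s ≤ θ * ρ * (Literature.MathematicalPhysics.QuantumManyBody.BoseGas.scatteringLength v).toReal → (⨅ Ψ : Literature.MathematicalPhysics.QuantumManyBody.BoseGas.PeriodicTrialState N (Literature.MathematicalPhysics.QuantumManyBody.BoseGas.sideLength ρ N), (Literature.MathematicalPhysics.QuantumManyBody.BoseGas.periodicEnergy v Ψ + ENNReal.ofReal s * ((N : ENNReal) - Literature.MathematicalPhysics.QuantumManyBody.BoseGas.condensateOccupation N (Literature.MathematicalPhysics.QuantumManyBody.BoseGas.sideLength ρ N) Ψ.ψ))) + ENNReal.ofReal (s / (θ * ρ * (Literature.MathematicalPhysics.QuantumManyBody.BoseGas.scatteringLength v).toReal)) * Literature.MathematicalPhysics.QuantumManyBody.BoseGas.periodicGroundStateEnergy v N (Literature.MathematicalPhysics.QuantumManyBody.BoseGas.sideLength ρ N) ≤ Literature.MathematicalPhysics.QuantumManyBody.BoseGas.periodicGroundStateEnergy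 v N (Literature.MathematicalPhysics.QuantumManyBody.BoseGas.sideLength ρ N) + ENNReal.ofReal (s / (θ * ρ * (Literature.MathematicalPhysics.QuantumManyBody.BoseGas.scatteringLength v).toReal)) * (⨅ Ψ : Literature.MathematicalPhysics.QuantumManyBody.BoseGas.PeriodicTrialState N (Literature.MathematicalPhysics.QuantumManyBody.BoseGas.sideLength ρ N), (Literature.MathematicalPhysics.QuantumManyBody.BoseGas.periodicEnergy v Ψ + ENNReal.ofReal (θ * ρ * (Literature.MathematicalPhysics.QuantumManyBody.BoseGas.scatteringLength v).toReal) * ((N : ENNReal) - Literature.MathematicalPhysics.QuantumManyBody.BoseGas.condensateOccupation N (Literature.MathematicalPhysics.QuantumManyBody.BoseGas.sideLength ρ N) Ψ.ψ))) + ENNReal.ofReal (s * τ * N) := by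
  have hKink := stub_noKinkOfSimple
  have hMod := stub_modulusOfSimple
  have hW2 := stub_chordFromModulus
  obtain ⟨η₁, c, ρ₁, hη₁, hc, hρ₁, hG⟩ := hGap
  obtain ⟨η₂, C, ρ₂, hη₂, hC, hρ₂, hV⟩ := hVar
  obtain ⟨θ, hθ, hθ1, hW⟩ := hW2 v (min η₁ η₂) c C τ (lt_min hη₁ hη₂) hc hC hτ
  obtain ⟨ρ₃, hρ₃, hR1⟩ :=
    Summit.AtomisticToContinuum.BoseEinsteinCondensation.Theorems.rewardScaleChord_proof v hv (min η₁ η₂ / 4) θ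
      (by positivity) hθ
  obtain ⟨ρ₄, hρ₄, hFin⟩ :=
    Summit.AtomisticToContinuum.BoseEinsteinCondensation.Theses.BECRewardDescent.PeriodicEnergyFinite_holds v hv
  obtain ⟨ρ₅, hρ₅, hS⟩ := hSimple
  refine ⟨θ, min ρ₁ (min ρ₂ (min ρ₃ (min ρ₄ ρ₅))), hθ,
    lt_min hρ₁ (lt_min hρ₂ (lt_min hρ₃ (lt_min hρ₄ hρ₅))), fun ρ hρ hρlt => ?_⟩
  have h1 : ρ < ρ₁ := lt_of_lt_of_le hρlt (min_le_left _ _)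
  have h2 : ρ < ρ₂ := lt_of_lt_of_le hρlt ((min_le_right _ _).trans (min_le_left _ _))
  have h3 : ρ < ρ₃ :=
    lt_of_lt_of_le hρlt ((min_le_right _ _).trans ((min_le_right _ _).trans (min_le_left _ _)))
  have h4 : ρ < ρ₄ := lt_of_lt_of_le hρlt
    ((min_le_right _ _).trans ((min_le_right _ _).trans ((min_le_right _ _).trans (min_le_left _ _))))
  have h5 : ρ < ρ₅ := lt_of_lt_of_le hρlt
    ((min_le_right _ _).trans ((min_le_right _ _).trans ((min_le_right _ _).trans (min_le_right _ _))))
  have hN0 : ∀ N : ℕ, (0 : ℝ) ≤ N := fun N => N.cast_nonneg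
  have hη₁' : ∀ N : ℕ, (1 - η₁) * (N : ℝ) ≤ (1 - min η₁ η₂) * N := fun N =>
    mul_le_mul_of_nonneg_right (by linarith [min_le_left η₁ η₂]) (hN0 N)
  have hη₂' : ∀ N : ℕ, (1 - η₂) * (N : ℝ) ≤ (1 - min η₁ η₂) * N := fun N =>
    mul_le_mul_of_nonneg_right (by linarith [min_le_right η₁ η₂]) (hN0 N)
  filter_upwards [hG ρ hρ h1, hV ρ hρ h2, hR1 ρ hρ h3, hFin ρ hρ h4, hS ρ hρ h5] with N hGN hVN hRN hFN hSN
  -- every `R(t)` is finite: `R(t) ≤ E(Ψ) + tN` for a finite-energy `Ψ`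
  have hRt : ∀ t : ℝ, (⨅ Ψ : Literature.MathematicalPhysics.QuantumManyBody.BoseGas.PeriodicTrialState N (Literature.MathematicalPhysics.QuantumManyBody.BoseGas.sideLength ρ N), (Literature.MathematicalPhysics.QuantumManyBody.BoseGas.periodicEnergy v Ψ + ENNReal.ofReal t * ((N : ENNReal) - Literature.MathematicalPhysics.QuantumManyBody.BoseGas.condensateOccupation N (Literature.MathematicalPhysics.QuantumManyBody.BoseGas.sideLength ρ N) Ψ.ψ))) ≠ ⊤ := fun t =>
    Summit.AtomisticToContinuum.BoseEinsteinCondensation.Theorems.WalkGlue.iInf_affine_ne_top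
      (fun Ψ : Literature.MathematicalPhysics.QuantumManyBody.BoseGas.PeriodicTrialState N (Literature.MathematicalPhysics.QuantumManyBody.BoseGas.sideLength ρ N) => Literature.MathematicalPhysics.QuantumManyBody.BoseGas.periodicEnergy v Ψ)
      (fun Ψ : Literature.MathematicalPhysics.QuantumManyBody.BoseGas.PeriodicTrialState N (Literature.MathematicalPhysics.QuantumManyBody.BoseGas.sideLength ρ N) => ((N : ENNReal) - Literature.MathematicalPhysics.QuantumManyBody.BoseGas.condensateOccupation N (Literature.MathematicalPhysics.QuantumManyBody.BoseGas.sideLength ρ N) Ψ.ψ))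
      (M := (N : ENNReal)) (fun Ψ => tsub_le_self) (ENNReal.natCast_ne_top N) hFN t
  refine hW ρ N hFN (fun hpos => hRN _ hpos le_rfl) ?_ ?_
  · intro s hs ε hε
    exact hKink v hv N _ s hs (hRt s) (hSN s hs (hRt s)).1 ε hε
  · intro s h hh hhs hsa hlt hcond
    have hs : 0 < s := hh.trans hhs
    have hg : 0 < c * Real.sqrt (ρ * (Literature.MathematicalPhysics.QuantumManyBody.BoseGas.scatteringLength v).toReal) * Real.sqrt s :=
      lt_of_le_of_lt (by positivity) hlt
    obtain ⟨δ, hδ, hΨ⟩ := hcond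
    refine hMod v hv N _ s h (c * Real.sqrt (ρ * (Literature.MathematicalPhysics.QuantumManyBody.BoseGas.scatteringLength v).toReal) * Real.sqrt s) (C * N) hh hhs hg hlt (hRt s) ?_ ?_ ?_
    · intro t ht₁ ht₂ δ' hδ'
      have ht : 0 < t := by linarith
      exact (hSN t ht (hRt t)).2 δ' hδ'
    · intro Φ₁ Φ₂ hΦ₁ hΦ₂ horth
      exact hGN s hs hsa ⟨δ, hδ, fun Ψ hF => (ENNReal.ofReal_le_ofReal (hη₁' N)).trans (hΨ Ψ hF)⟩
        Φ₁ Φ₂ hΦ₁ hΦ₂ horth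
    · exact hVN s hs hsa ⟨δ, hδ, fun Ψ hF => (ENNReal.ofReal_le_ofReal (hη₂' N)).trans (hΨ Ψ hF)⟩

/-- **The crux for INTEGRABLE potentials, modulo the two Bogoliubov cruxes only.** If `SectorGap` and
`CondensateVariance` hold, then for every repulsive finite-range `v` with `∫_(ℝ³) v(|x|) dx < ∞` (soft cores) and every
`τ > 0` the body of `RewardChordBound` holds at `v` — the Perron–Frobenius input is supplied by the landed
`stub_rewardedKyFanGapIntegrable` / `stub_rewardedZeroMomentumIntegrable` (every `N ≥ 1`, `L = (N/ρ)^(1/3) > 0`, `s > 0`).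
[folklore] -/
theorem rewardChordBound_integrable_of_sectorGap_of_condensateVariance
    (hGap : Summit.AtomisticToContinuum.BoseEinsteinCondensation.Theses.BECRewardDescent.SectorGap) (hVar : Summit.AtomisticToContinuum.BoseEinsteinCondensation.Theses.BECRewardDescent.CondensateVariance)
    (v : ℝ → ENNReal) (hv : Literature.MathematicalPhysics.QuantumManyBody.BoseGas.IsRepulsiveFiniteRange v) (hint : (∫⁻ x : Literature.MathematicalPhysics.QuantumManyBody.BoseGas.Space, v ‖x‖) ≠ ⊤) (τ : ℝ) (hτ : 0 < τ) :
    ∃ θ ρ₀ : ℝ, 0 < θ ∧ 0 < ρ₀ ∧ ∀ ρ : ℝ, 0 < ρ → ρ < ρ₀ → ∀ᶠ N : ℕ in Filter.atTop, ∀ s : ℝ, 0 < s → s ≤ θ * ρ * (Literature.MathematicalPhysics.QuantumManyBody.BoseGas.scatteringLength v).toReal → (⨅ Ψ : Literature.MathematicalPhysics.QuantumManyBody.BoseGas.PeriodicTrialState N (Literature.MathematicalPhysics.QuantumManyBody.BoseGas.sideLength ρ N), (Literature.MathematicalPhysics.QuantumManyBody.BoseGas.periodicEnergy v Ψ + ENNReal.ofReal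 s * ((N : ENNReal) - Literature.MathematicalPhysics.QuantumManyBody.BoseGas.condensateOccupation N (Literature.MathematicalPhysics.QuantumManyBody.BoseGas.sideLength ρ N) Ψ.ψ))) + ENNReal.ofReal (s / (θ * ρ * (Literature.MathematicalPhysics.QuantumManyBody.BoseGas.scatteringLength v).toReal)) * Literature.MathematicalPhysics.QuantumManyBody.BoseGas.periodicGroundStateEnergy v N (Literature.MathematicalPhysics.QuantumManyBody.BoseGas.sideLength ρ N) ≤ Literature.MathematicalPhysics.QuantumManyBody.BoseGas.periodicGroundStateEnergy v N (Literature.MathematicalPhysics.QuantumManyBody.BoseGas.sideLength ρ N) + ENNReal.ofReal (s / (θ * ρ * (Literature.MathematicalPhysics.QuantumManyBody.BoseGas.scatteringLength v).toReal)) * (⨅ Ψ : Literature.MathematicalPhysics.QuantumManyBody.BoseGas.PeriodicTrialState N (Literature.MathematicalPhysics.QuantumManyBody.BoseGas.sideLength ρ N), (Literature.MathematicalPhysics.QuantumManyBody.BoseGas.periodicEnergy v Ψ + ENNReal.ofReal (θ * ρ * (Literature.MathematicalPhysics.QuantumManyBody.BoseGas.scatteringLength v).toReal) * ((N : ENNReal)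 - Literature.MathematicalPhysics.QuantumManyBody.BoseGas.condensateOccupation N (Literature.MathematicalPhysics.QuantumManyBody.BoseGas.sideLength ρ N) Ψ.ψ))) + ENNReal.ofReal (s * τ * N) := by
  refine rewardChordBound_at v hv τ hτ (hGap v hv) (hVar v hv) ⟨1, one_pos, fun ρ hρ _ => ?_⟩
  filter_upwards [Filter.eventually_ge_atTop 1] with N hN s hs hRs
  have hL : 0 < Literature.MathematicalPhysics.QuantumManyBody.BoseGas.sideLength ρ N :=
    Real.rpow_pos_of_pos (div_pos (Nat.cast_pos.2 hN) hρ) _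
  exact ⟨stub_rewardedKyFanGapIntegrable v hv hint N _ s hN hL hs hRs,
    stub_rewardedZeroMomentumIntegrable v hv hint N _ s hN hL hs hRs⟩

/-- **The crux reduced to its three named open inputs (all admissible potentials, hard cores included).**
`SectorGap → CondensateVariance → NonintegrableSimple → RewardChordBound`, where `NonintegrableSimple` is verbatim the
line's open stub `stub_rewardedSimpleNonintegrable`: for repulsive finite-range `v` with `∫ v(|x|)dx = ∞`, at low density,
eventually in `N`, for every `s > 0` with `R(s) < ∞`, a strict all-pairs Ky-Fan gap of `F_s` and translation-invariant
near-minimisers (the hard-core Perron–Frobenius kernel, cf. crux `HardCoreExtension`). Integrable `v` need no third input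
(`rewardChordBound_integrable_of_sectorGap_of_condensateVariance`). This is the skeleton `RewardChordBound_of` of
`Lines/birth.lean` with its three `sorry`s read as hypotheses. [folklore] -/
theorem rewardChordBound_of_sectorGap_of_condensateVariance_of_nonintegrableSimple
    (hGap : Summit.AtomisticToContinuum.BoseEinsteinCondensation.Theses.BECRewardDescent.SectorGap) (hVar : Summit.AtomisticToContinuum.BoseEinsteinCondensation.Theses.BECRewardDescent.CondensateVariance)
    (hNI : ∀ v : ℝ → ENNReal, Literature.MathematicalPhysics.QuantumManyBody.BoseGas.IsRepulsiveFiniteRange v → (∫⁻ x : Literature.MathematicalPhysics.QuantumManyBody.BoseGas.Space, v ‖x‖) = ⊤ → ∃ ρ₀ : ℝ, 0 < ρ₀ ∧ ∀ ρ : ℝ, 0 < ρ → ρ < ρ₀ → ∀ᶠ N : ℕ in Filter.atTop, ∀ s : ℝ, 0 < s → (⨅ Ψ : Literature.MathematicalPhysics.QuantumManyBody.BoseGas.PeriodicTrialState N (Literature.MathematicalPhysics.QuantumManyBody.BoseGas.sideLength ρ N), (Literature.MathematicalPhysics.QuantumManyBody.BoseGas.periodicEnergy v Ψ + ENNReal.ofReal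 s * ((N : ENNReal) - Literature.MathematicalPhysics.QuantumManyBody.BoseGas.condensateOccupation N (Literature.MathematicalPhysics.QuantumManyBody.BoseGas.sideLength ρ N) Ψ.ψ))) ≠ ⊤ → (∃ g : ℝ, 0 < g ∧ (∀ Φ₁ Φ₂ : Literature.MathematicalPhysics.QuantumManyBody.BoseGas.PeriodicTrialState N (Literature.MathematicalPhysics.QuantumManyBody.BoseGas.sideLength ρ N), (∫ X in Literature.MathematicalPhysics.QuantumManyBody.BoseGas.cellN N (Literature.MathematicalPhysics.QuantumManyBody.BoseGas.sideLength ρ N), starRingEnd ℂ (Φ₁.ψ X) * Φ₂.ψ X) = 0 → 2 * (⨅ Ψ : Literature.MathematicalPhysics.QuantumManyBody.BoseGas.PeriodicTrialState N (Literature.MathematicalPhysics.QuantumManyBody.BoseGas.sideLength ρ N), (Literature.MathematicalPhysics.QuantumManyBody.BoseGas.periodicEnergy v Ψ + ENNReal.ofReal s * ((N : ENNReal) - Literature.MathematicalPhysics.QuantumManyBody.BoseGas.condensateOccupation N (Literature.MathematicalPhysics.QuantumManyBody.BoseGas.sideLength ρ N) Ψ.ψ))) + ENNReal.ofReal g ≤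 (Literature.MathematicalPhysics.QuantumManyBody.BoseGas.periodicEnergy v Φ₁ + ENNReal.ofReal s * ((N : ENNReal) - Literature.MathematicalPhysics.QuantumManyBody.BoseGas.condensateOccupation N (Literature.MathematicalPhysics.QuantumManyBody.BoseGas.sideLength ρ N) Φ₁.ψ)) + (Literature.MathematicalPhysics.QuantumManyBody.BoseGas.periodicEnergy v Φ₂ + ENNReal.ofReal s * ((N : ENNReal) - Literature.MathematicalPhysics.QuantumManyBody.BoseGas.condensateOccupation N (Literature.MathematicalPhysics.QuantumManyBody.BoseGas.sideLength ρ N) Φ₂.ψ)))) ∧ (∀ δ : ENNReal, 0 < δ → ∃ Ψ : Literature.MathematicalPhysics.QuantumManyBody.BoseGas.PeriodicTrialState N (Literature.MathematicalPhysics.QuantumManyBody.BoseGas.sideLength ρ N), (∀ (X : Literature.MathematicalPhysics.QuantumManyBody.BoseGas.Config N) (t : EuclideanSpace ℝ (Fin 3)), Ψ.ψ (fun i => X i + t) = Ψ.ψ X) ∧ (Literature.MathematicalPhysics.QuantumManyBody.BoseGas.periodicEnergy v Ψ + ENNReal.ofReal s * ((N : ENNReal) - Literature.MathematicalPhysics.QuantumManyBody.BoseGas.condensateOccupation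 N (Literature.MathematicalPhysics.QuantumManyBody.BoseGas.sideLength ρ N) Ψ.ψ)) ≤ (⨅ Ψ : Literature.MathematicalPhysics.QuantumManyBody.BoseGas.PeriodicTrialState N (Literature.MathematicalPhysics.QuantumManyBody.BoseGas.sideLength ρ N), (Literature.MathematicalPhysics.QuantumManyBody.BoseGas.periodicEnergy v Ψ + ENNReal.ofReal s * ((N : ENNReal) - Literature.MathematicalPhysics.QuantumManyBody.BoseGas.condensateOccupation N (Literature.MathematicalPhysics.QuantumManyBody.BoseGas.sideLength ρ N) Ψ.ψ))) + δ)) :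
    Summit.AtomisticToContinuum.BoseEinsteinCondensation.Theses.BECRewardDescent.RewardChordBound := by
  intro v hv τ hτ
  by_cases hint : (∫⁻ x : Literature.MathematicalPhysics.QuantumManyBody.BoseGas.Space, v ‖x‖) = ⊤
  · exact rewardChordBound_at v hv τ hτ (hGap v hv) (hVar v hv) (hNI v hv hint)
  · exact rewardChordBound_integrable_of_sectorGap_of_condensateVariance hGap hVar v hv hint τ hτ

/-- Registered anchor of this helper file on crux stmt-AtomisticToContinuum-12876 (the gate matches `--supports` files to
registered stubs by name and signature): `SectorGap → CondensateVariance → NonintegrableSimple → RewardChordBound`,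
by `rewardChordBound_of_sectorGap_of_condensateVariance_of_nonintegrableSimple`. [folklore] -/
theorem stub_rewardChordBoundReduction :
    Summit.AtomisticToContinuum.BoseEinsteinCondensation.Theses.BECRewardDescent.SectorGap → Summit.AtomisticToContinuum.BoseEinsteinCondensation.Theses.BECRewardDescent.CondensateVariance →
    (∀ v : ℝ → ENNReal, Literature.MathematicalPhysics.QuantumManyBody.BoseGas.IsRepulsiveFiniteRange v → (∫⁻ x : Literature.MathematicalPhysics.QuantumManyBody.BoseGas.Space, v ‖x‖) = ⊤ → ∃ ρ₀ : ℝ, 0 < ρ₀ ∧ ∀ ρ : ℝ, 0 < ρ → ρ < ρ₀ → ∀ᶠ N : ℕ in Filter.atTop, ∀ s : ℝ, 0 < s → (⨅ Ψ : Literature.MathematicalPhysics.QuantumManyBody.BoseGas.PeriodicTrialState N (Literature.MathematicalPhysics.QuantumManyBody.BoseGas.sideLength ρ N), (Literature.MathematicalPhysics.QuantumManyBody.BoseGas.periodicEnergy v Ψ + ENNReal.ofReal s * ((N : ENNReal) - Literature.MathematicalPhysics.QuantumManyBody.BoseGas.condensateOccupation N (Literature.MathematicalPhysics.QuantumManyBody.BoseGas.sideLength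 ρ N) Ψ.ψ))) ≠ ⊤ → (∃ g : ℝ, 0 < g ∧ (∀ Φ₁ Φ₂ : Literature.MathematicalPhysics.QuantumManyBody.BoseGas.PeriodicTrialState N (Literature.MathematicalPhysics.QuantumManyBody.BoseGas.sideLength ρ N), (∫ X in Literature.MathematicalPhysics.QuantumManyBody.BoseGas.cellN N (Literature.MathematicalPhysics.QuantumManyBody.BoseGas.sideLength ρ N), starRingEnd ℂ (Φ₁.ψ X) * Φ₂.ψ X) = 0 → 2 * (⨅ Ψ : Literature.MathematicalPhysics.QuantumManyBody.BoseGas.PeriodicTrialState N (Literature.MathematicalPhysics.QuantumManyBody.BoseGas.sideLength ρ N), (Literature.MathematicalPhysics.QuantumManyBody.BoseGas.periodicEnergy v Ψ + ENNReal.ofReal s * ((N : ENNReal) - Literature.MathematicalPhysics.QuantumManyBody.BoseGas.condensateOccupation N (Literature.MathematicalPhysics.QuantumManyBody.BoseGas.sideLength ρ N) Ψ.ψ))) + ENNReal.ofReal g ≤ (Literature.MathematicalPhysics.QuantumManyBody.BoseGas.periodicEnergy v Φ₁ + ENNReal.ofReal s * ((N : ENNReal) - Literature.MathematicalPhysics.QuantumManyBody.BoseGas.condensateOccupation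 N (Literature.MathematicalPhysics.QuantumManyBody.BoseGas.sideLength ρ N) Φ₁.ψ)) + (Literature.MathematicalPhysics.QuantumManyBody.BoseGas.periodicEnergy v Φ₂ + ENNReal.ofReal s * ((N : ENNReal) - Literature.MathematicalPhysics.QuantumManyBody.BoseGas.condensateOccupation N (Literature.MathematicalPhysics.QuantumManyBody.BoseGas.sideLength ρ N) Φ₂.ψ)))) ∧ (∀ δ : ENNReal, 0 < δ → ∃ Ψ : Literature.MathematicalPhysics.QuantumManyBody.BoseGas.PeriodicTrialState N (Literature.MathematicalPhysics.QuantumManyBody.BoseGas.sideLength ρ N), (∀ (X : Literature.MathematicalPhysics.QuantumManyBody.BoseGas.Config N) (t : EuclideanSpace ℝ (Fin 3)), Ψ.ψ (fun i => X i + t) = Ψ.ψ X) ∧ (Literature.MathematicalPhysics.QuantumManyBody.BoseGas.periodicEnergy v Ψ + ENNReal.ofReal s * ((N : ENNReal) - Literature.MathematicalPhysics.QuantumManyBody.BoseGas.condensateOccupation N (Literature.MathematicalPhysics.QuantumManyBody.BoseGas.sideLength ρ N) Ψ.ψ)) ≤ (⨅ Ψ : Literature.MathematicalPhysics.QuantumManyBody.BoseGas.PeriodicTrialState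 N (Literature.MathematicalPhysics.QuantumManyBody.BoseGas.sideLength ρ N), (Literature.MathematicalPhysics.QuantumManyBody.BoseGas.periodicEnergy v Ψ + ENNReal.ofReal s * ((N : ENNReal) - Literature.MathematicalPhysics.QuantumManyBody.BoseGas.condensateOccupation N (Literature.MathematicalPhysics.QuantumManyBody.BoseGas.sideLength ρ N) Ψ.ψ))) + δ)) →
    Summit.AtomisticToContinuum.BoseEinsteinCondensation.Theses.BECRewardDescent.RewardChordBound :=
  rewardChordBound_of_sectorGap_of_condensateVariance_of_nonintegrableSimple

end Summit.AtomisticToContinuum.BoseEinsteinCondensation.Cruxes.RewardChordBound.Birth
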